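import Summits.Ventures.YMGap.RobustBall.IndexedMemberFR
import Summits.Ventures.YMGap.RobustBall.TrailLoopFamily
import Summits.Ventures.YMGap.RobustBall.WalkTranslation
import Summits.Ventures.YMGap.RobustBall.RowsSU2
import Summits.Ventures.YMGap.RobustBall.RowsSUNCells
import Summits.Ventures.YMGap.RobustBall.RowsDim3
import HarnessLib

/-!
# Venture YMGap, track ROBUST-BALL (tier 1) — FINITE-RANGE loop actions: the unweighted loop-action norm ball is
# inside the tier-1 ball `MemBallZd`, so the tier-1 rows (twice the coupling) apply

HONEST FRAMING. WHAT THIS IS: a venture file (cell `pub-ymgap`, track Y2 ROBUST-BALL, seat rb-p1), the finite-range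
companion of `LoopActionMember.lean`. A generic Wilson-type loop action `loopFamilyAction N γ c` whose loops have
`ℓ^∞`-extent `≤ R`, with finitely many loops through every link and finite carrier fibres, lies in rb-p1's TIER-1 ball
`MemBallZd (2ε) ε R W (loopSupp γ)` as soon as the UNWEIGHTED norm is at most `ε`: `LoopNormLE 0 γ c ε`, i.e.
`∑_{i : e ∈ γ_i} |c_i| · |γ_i| ≤ ε` through every link (`memBallZd_loopFamilyAction`, via `memBallZd_indexed`). Hence EVERY
tier-1 row `MassGapOnBallZd d N β (2ε) ε R` gives the mass gap (`perturbedMassGapAtS_loopFamilyAction_of_tier1`) — at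
TWICE the Wilson coupling of the weight-`2^{dist}` tier-2 cells: `SU(2)`, `d = 4`: `β_W = 1/8` for `‖c‖₀ ≤ 0.143`,
`β_W = 1/10` for `0.209`, `β_W = 3/20` for `0.085`, `β_W = 1/6` for `0.049`; every `N ≥ 2` at 't Hooft `|β| ≤ 1/64` for
`‖c‖₀ ≤ 0.11` (`ℤ⁴`) and `|β| ≤ 1/48` for `0.149` (`ℤ³`); `SU(2)` on `ℤ³` at `β_W = 1/5` for `0.123`. Canonical instance:
ALL closed trails of length `≤ L₀` (`trailLoopLE L₀`, extent `2L₀`; `su2_trailsLE_massGapS_1_8`). WHAT IT IS NOT: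
strong-coupling lattice statements inside the rows' windows; nothing about the continuum limit or the Clay problem.

References: this track's `MassGapOnBall.lean`, `RowsSU2.lean`, `RowsSUNCells.lean`, `RowsDim3.lean` (tier-1 rows),
`LoopActionMember.lean`, `TrailLoopFamily.lean`, `IndexedMemberFR.lean`.
-/

noncomputable section

open MeasureTheory Function Real SimpleGraph
open Literature.Probability.LatticeModels
open Literature.Probability.LatticeModels.DobrushinMetric
open Literature.MathematicalPhysics.QuantumLattice
open Literature.MathematicalPhysics.QuantumFieldTheory (walkEdges card_walkEdges_of_isTrail)

namespace Summit.Ventures.YMGap.RobustBall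

variable {d N : ℕ} {ι : Type*}

/-! ### Finite-range loop families are tier-1 members -/

section Member

/-- **The support family of a loop action**: carriers of the loops through the links of a volume. -/
abbrev loopSupp (γ : ι → ZdLoop d) : Finset (ZdEdge d) → Finset (Finset (ZdEdge d)) :=
  indexedSupp fun i => walkEdges (γ i).walk

variable {γ : ι → ZdLoop d} {c : ι → ℝ} {ε R : ℝ}

/-- `1/√N ≤ 1` for every natural `N` (`= 0` for `N = 0`). -/
theorem inv_sqrt_natCast_le_one (N : ℕ) : (Real.sqrt N)⁻¹ ≤ 1 := by
  rcases Nat.eq_zero_or_pos N with hN | hN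
  · subst hN; simp
  · have h1 : (1 : ℝ) ≤ Real.sqrt N := by
      rw [← Real.sqrt_one]; exact Real.sqrt_le_sqrt (by exact_mod_cast hN)
    exact inv_le_one_of_one_le₀ h1

/-- **FINITE-RANGE LOOP ACTIONS ARE TIER-1 MEMBERS**: finite carrier fibres, finitely many loops through every link,
loops of `ℓ^∞`-extent `≤ R`, and unweighted norm `‖c‖₀ ≤ ε` (`LoopNormLE 0 γ c ε`) give
`(loopFamilyAction N γ c, loopSupp γ) ∈ MemBallZd (2ε) ε R`. -/
theorem memBallZd_loopFamilyAction (hfin : ∀ X, {i | walkEdges (γ i).walk = X}.Finite)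
    (hthr : ∀ e : ZdEdge d, {i | e ∈ walkEdges (γ i).walk}.Finite)
    (hR : ∀ i, ∀ e ∈ walkEdges (γ i).walk, ∀ y ∈ walkEdges (γ i).walk, ‖e.1 - y.1‖ ≤ R) (h : LoopNormLE 0 γ c ε) :
    MemBallZd (2 * ε) ε R (loopFamilyAction (d := d) N γ c) (loopSupp γ) := by
  have hW0 := loopWeightAt_nonneg (0 : ℝ) γ c
  -- the finite per-link sums are bounded by the norm
  have hsumle : ∀ e : ZdEdge d, ∑ i ∈ throughFib (fun i => walkEdges (γ i).walk) e, loopWeightAt 0 γ c e i ≤ ε :=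
    fun e => ((h.summable e).sum_le_tsum _ fun i _ => hW0 e i).trans (h.tsum_le e)
  refine memBallZd_indexed (code := fun i => walkEdges (γ i).walk) (fib := carrierFib fun i => walkEdges (γ i).walk)
    (φ := fun i => loopTerm N (c i) (γ i).walk) (mem_carrierFib hfin) hthr (fun i => continuous_loopTerm (γ i).walk)
    (fun i => dependsOn_loopTerm (γ i).walk) (fun i => isOscBound_loopTerm (γ i).walk)
    (fun i => isLipBound_loopTerm (γ i).walk) (fun i y hy => ?_) hR (fun e => ?_) (fun e => ?_)
  · -- Lipschitz witnesses vanish off the carrier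
    simp only [dartMult_eq_zero_of_not_mem _ hy, Nat.cast_zero, zero_div, mul_zero]
  · -- oscillation load `∑ 2|c_i| ≤ 2ε`
    have hle : ∀ i ∈ throughFib (fun i => walkEdges (γ i).walk) e, 2 * |c i| ≤ 2 * loopWeightAt 0 γ c e i :=
      fun i hi => mul_le_mul_of_nonneg_left (abs_coupling_le_loopWeightAt ((mem_throughFib hthr e i).1 hi)) (by norm_num)
    refine (Finset.sum_le_sum hle).trans ?_
    rw [← Finset.mul_sum]
    linarith [hsumle e]
  · -- cross-Lipschitz load `≤ ε`
    refine (Finset.sum_le_sum fun i hi => ?_).trans (hsumle e)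
    have he := (mem_throughFib hthr e i).1 hi
    have h1 := sum_erase_le_loopWeightAt (w := (0 : ℝ)) (c := c) he
    simp only [zero_mul, exp_zero, mul_one] at h1
    calc ∑ y ∈ (walkEdges (γ i).walk).erase e, |c i| * (dartMult (γ i).walk y / Real.sqrt N)
        = (Real.sqrt N)⁻¹ * ∑ y ∈ (walkEdges (γ i).walk).erase e, |c i| * (dartMult (γ i).walk y : ℝ) := by
          rw [Finset.mul_sum]
          exact Finset.sum_congr rfl fun y _ => by rw [div_eq_mul_inv]; ring
      _ ≤ 1 * loopWeightAt 0 γ c e i :=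
          mul_le_mul (inv_sqrt_natCast_le_one N) h1 (Finset.sum_nonneg fun y _ => by positivity) zero_le_one
      _ = loopWeightAt 0 γ c e i := one_mul _

/-- **Mass gap for finite-range loop actions from a TIER-1 row**: `MassGapOnBallZd d N β (2ε) ε R` and the
hypotheses of `memBallZd_loopFamilyAction` give `PerturbedMassGapAtS d N β (loopFamilyAction N γ c)` (the tier-1 and
tier-2 mass-gap predicates agree on supported potentials). -/
theorem perturbedMassGapAtS_loopFamilyAction_of_tier1 {β : ℝ} (hrow : MassGapOnBallZd d N β (2 * ε) ε R)
    (hfin : ∀ X, {i | walkEdges (γ i).walk = X}.Finite) (hthr : ∀ e : ZdEdge d, {i | e ∈ walkEdges (γ i).walk}.Finite)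
    (hR : ∀ i, ∀ e ∈ walkEdges (γ i).walk, ∀ y ∈ walkEdges (γ i).walk, ‖e.1 - y.1‖ ≤ R) (h : LoopNormLE 0 γ c ε) :
    PerturbedMassGapAtS d N β (loopFamilyAction (d := d) N γ c) :=
  (perturbedMassGapAtS_iff_of_supportedBy β (memBallZd_loopFamilyAction hfin hthr hR h).supportedBy).2
    (hrow _ _ (memBallZd_loopFamilyAction hfin hthr hR h))

end Member

/-! ### Cells from the tier-1 rows (twice the coupling of the tier-2 cells) -/

section Rows

variable {γ : ι → ZdLoop 4} {c : ι → ℝ} {R : ℝ}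

/-- **`SU(2)`, `d = 4`, `β_W = 1/8`**: every finite-range loop action with `‖c‖₀ ≤ 0.143` has the mass gap
(tier-1 row `su2_rowB_1_8`; the weighted tier-2 cell has the same radius at `β_W = 1/16`). -/
theorem su2_loopFamilyFR_massGapS_1_8 (hfin : ∀ X, {i | walkEdges (γ i).walk = X}.Finite)
    (hthr : ∀ e : ZdEdge 4, {i | e ∈ walkEdges (γ i).walk}.Finite)
    (hR : ∀ i, ∀ e ∈ walkEdges (γ i).walk, ∀ y ∈ walkEdges (γ i).walk, ‖e.1 - y.1‖ ≤ R)
    (h : LoopNormLE 0 γ c (143 / 1000)) : PerturbedMassGapAtS 4 2 ((1 / 8 : ℝ) / 4) (loopFamilyAction (d := 4) 2 γ c) :=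
  perturbedMassGapAtS_loopFamilyAction_of_tier1 (su2_rowB_1_8 R) hfin hthr hR h

/-- **`SU(2)`, `d = 4`, `β_W = 1/10`**: radius `0.209` (tier-1 row `su2_rowB_1_10`). -/
theorem su2_loopFamilyFR_massGapS_1_10 (hfin : ∀ X, {i | walkEdges (γ i).walk = X}.Finite)
    (hthr : ∀ e : ZdEdge 4, {i | e ∈ walkEdges (γ i).walk}.Finite)
    (hR : ∀ i, ∀ e ∈ walkEdges (γ i).walk, ∀ y ∈ walkEdges (γ i).walk, ‖e.1 - y.1‖ ≤ R)
    (h : LoopNormLE 0 γ c (209 / 1000)) : PerturbedMassGapAtS 4 2 ((1 / 10 : ℝ) / 4) (loopFamilyAction (d := 4) 2 γ c) :=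
  perturbedMassGapAtS_loopFamilyAction_of_tier1 (su2_rowB_1_10 R) hfin hthr hR h

/-- **`SU(2)`, `d = 4`, `β_W = 3/20`**: radius `0.085` (tier-1 row `su2_rowB_3_20`). -/
theorem su2_loopFamilyFR_massGapS_3_20 (hfin : ∀ X, {i | walkEdges (γ i).walk = X}.Finite)
    (hthr : ∀ e : ZdEdge 4, {i | e ∈ walkEdges (γ i).walk}.Finite)
    (hR : ∀ i, ∀ e ∈ walkEdges (γ i).walk, ∀ y ∈ walkEdges (γ i).walk, ‖e.1 - y.1‖ ≤ R)
    (h : LoopNormLE 0 γ c (17 / 200)) : PerturbedMassGapAtS 4 2 ((3 / 20 : ℝ) / 4) (loopFamilyAction (d := 4) 2 γ c) :=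
  perturbedMassGapAtS_loopFamilyAction_of_tier1 (su2_rowB_3_20 R) hfin hthr hR h

/-- **`SU(2)`, `d = 4`, `β_W = 1/6`**: radius `0.049` (tier-1 row `su2_rowB_1_6`, the door's edge). -/
theorem su2_loopFamilyFR_massGapS_1_6 (hfin : ∀ X, {i | walkEdges (γ i).walk = X}.Finite)
    (hthr : ∀ e : ZdEdge 4, {i | e ∈ walkEdges (γ i).walk}.Finite)
    (hR : ∀ i, ∀ e ∈ walkEdges (γ i).walk, ∀ y ∈ walkEdges (γ i).walk, ‖e.1 - y.1‖ ≤ R)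
    (h : LoopNormLE 0 γ c (49 / 1000)) : PerturbedMassGapAtS 4 2 ((1 / 6 : ℝ) / 4) (loopFamilyAction (d := 4) 2 γ c) :=
  perturbedMassGapAtS_loopFamilyAction_of_tier1 (su2_rowB_1_6 R) hfin hthr hR h

/-- **Every `N ≥ 2`, `d = 4`, 't Hooft `|β| ≤ 1/64`**: every finite-range loop action with `‖c‖₀ ≤ 0.11` has the mass
gap, `N`-uniformly (p1's tier-1 cell `suN_zdRow4_1_64`). -/
theorem suN_loopFamilyFR_massGapS_1_64 {N : ℕ} (hN : 2 ≤ N) {β : ℝ} (hβ : |β| ≤ 1 / 64) {γ : ι → ZdLoop 4} {c : ι → ℝ}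
    (hfin : ∀ X, {i | walkEdges (γ i).walk = X}.Finite) (hthr : ∀ e : ZdEdge 4, {i | e ∈ walkEdges (γ i).walk}.Finite)
    (hR : ∀ i, ∀ e ∈ walkEdges (γ i).walk, ∀ y ∈ walkEdges (γ i).walk, ‖e.1 - y.1‖ ≤ R)
    (h : LoopNormLE 0 γ c (11 / 100)) : PerturbedMassGapAtS 4 N β (loopFamilyAction (d := 4) N γ c) := by
  have hrow := RobustBallSUN.suN_zdRow4_1_64 hN hβ R
  have hrow' : MassGapOnBallZd 4 N β (2 * (11 / 100)) (11 / 100) R := by norm_num at hrow ⊢; exact hrow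
  exact perturbedMassGapAtS_loopFamilyAction_of_tier1 hrow' hfin hthr hR h

/-- **Every `N ≥ 2`, `d = 3`, 't Hooft `|β| ≤ 1/48`**: radius `0.149` on `ℤ³` (p1's tier-1 cell `suN_zdRow3_1_48`). -/
theorem suN_dim3_loopFamilyFR_massGapS_1_48 {N : ℕ} (hN : 2 ≤ N) {β : ℝ} (hβ : |β| ≤ 1 / 48) {γ : ι → ZdLoop 3}
    {c : ι → ℝ} (hfin : ∀ X, {i | walkEdges (γ i).walk = X}.Finite)
    (hthr : ∀ e : ZdEdge 3, {i | e ∈ walkEdges (γ i).walk}.Finite)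
    (hR : ∀ i, ∀ e ∈ walkEdges (γ i).walk, ∀ y ∈ walkEdges (γ i).walk, ‖e.1 - y.1‖ ≤ R)
    (h : LoopNormLE 0 γ c (149 / 1000)) : PerturbedMassGapAtS 3 N β (loopFamilyAction (d := 3) N γ c) := by
  have hrow := RobustBallSUN.suN_zdRow3_1_48 hN hβ R
  have hrow' : MassGapOnBallZd 3 N β (2 * (149 / 1000)) (149 / 1000) R := by norm_num at hrow ⊢; exact hrow
  exact perturbedMassGapAtS_loopFamilyAction_of_tier1 hrow' hfin hthr hR h

/-- **`SU(2)`, `d = 3`, `β_W = 1/5`**: every finite-range loop action on `ℤ³` with `‖c‖₀ ≤ 0.123` has the mass gap (tier-1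
row `su2_dim3_row_1_5`). -/
theorem su2_dim3_loopFamilyFR_massGapS_1_5 {γ : ι → ZdLoop 3} {c : ι → ℝ}
    (hfin : ∀ X, {i | walkEdges (γ i).walk = X}.Finite) (hthr : ∀ e : ZdEdge 3, {i | e ∈ walkEdges (γ i).walk}.Finite)
    (hR : ∀ i, ∀ e ∈ walkEdges (γ i).walk, ∀ y ∈ walkEdges (γ i).walk, ‖e.1 - y.1‖ ≤ R)
    (h : LoopNormLE 0 γ c (123 / 1000)) : PerturbedMassGapAtS 3 2 ((1 / 5 : ℝ) / 4) (loopFamilyAction (d := 3) 2 γ c) :=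
  perturbedMassGapAtS_loopFamilyAction_of_tier1 (RobustBallDim3.su2_dim3_row_1_5 R) hfin hthr hR h

end Rows

/-! ### All closed trails of bounded length -/

section Bounded

variable (d) in
/-- Index of ALL closed trails of `ℤ^d` of length between `1` and `L₀`. -/
abbrev TrailIdxLE (L₀ : ℕ) : Type := {γ : ZdLoop d // γ.walk.IsTrail ∧ 0 < γ.walk.length ∧ γ.walk.length ≤ L₀}

/-- **The bounded trail family**: inclusion of the closed trails of length `≤ L₀`. -/
def trailLoopLE (L₀ : ℕ) (i : TrailIdxLE d L₀) : ZdLoop d := i.1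

variable {L₀ : ℕ}

/-- The bounded trail family factors injectively through the trail family. -/
theorem trailLoopLE_eq (i : TrailIdxLE d L₀) : trailLoopLE L₀ i = trailLoop ⟨i.1, i.2.1, i.2.2.1⟩ := rfl

/-- Finite carrier fibres (from `finite_fibre_trailLoop`). -/
theorem finite_fibre_trailLoopLE (X : Finset (ZdEdge d)) :
    {i : TrailIdxLE d L₀ | walkEdges (trailLoopLE L₀ i).walk = X}.Finite := by
  have hinj : Injective fun i : TrailIdxLE d L₀ => (⟨i.1, i.2.1, i.2.2.1⟩ : TrailIdx d) := by
    intro i j h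
    exact Subtype.ext (congrArg Subtype.val h :)
  exact ((finite_fibre_trailLoop X).preimage hinj.injOn).subset fun i hi => hi

/-- Sup-norm balls of `ℤ^d` are finite. -/
theorem finite_ball_site (y : Site d) (r : ℝ) : {x : Site d | ‖x - y‖ ≤ r}.Finite := by
  have h : {x : Site d | ‖x - y‖ ≤ r} = Metric.closedBall y r := by
    ext x; simp [Metric.mem_closedBall, dist_eq_norm]
  rw [h]
  exact (isCompact_closedBall y r).finite_of_discrete

/-- **Finitely many bounded trails through every link**: a closed trail of length `≤ L₀` through `e` is based within
`ℓ^∞`-distance `L₀` of `e`. -/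
theorem finite_through_trailLoopLE (e : ZdEdge d) :
    {i : TrailIdxLE d L₀ | e ∈ walkEdges (trailLoopLE L₀ i).walk}.Finite := by
  classical
  obtain ⟨S, hS⟩ := (finite_ball_site (d := d) e.1 L₀).exists_finset_coe
  have hT : (⋃ n ∈ (Finset.range (L₀ + 1) : Set ℕ), {γ : ZdLoop d | γ.base ∈ S ∧ γ.walk.length = n}).Finite :=
    (Finset.finite_toSet _).biUnion fun n _ => finite_loops_of_base_mem_of_length S n
  refine (hT.preimage (Subtype.val_injective.injOn)).subset ?_
  rintro ⟨γ, htr, hpos, hle⟩ he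
  change e ∈ walkEdges γ.walk at he
  simp only [Set.mem_preimage, Set.mem_iUnion, Set.mem_setOf_eq, Finset.mem_coe, Finset.mem_range]
  refine ⟨γ.walk.length, Nat.lt_succ_of_le hle, ?_, rfl⟩
  rw [← Finset.mem_coe, hS, Set.mem_setOf_eq]
  have h1 := norm_sub_le_length_of_mem_support γ.walk (fst_mem_support_of_mem_walkEdges γ.walk he)
  rw [norm_sub_rev] at h1
  exact h1.trans (by exact_mod_cast hle)

/-- Links of a bounded trail are within `ℓ^∞`-distance `2L₀`. -/
theorem norm_sub_le_trailLoopLE (i : TrailIdxLE d L₀) : ∀ e ∈ walkEdges (trailLoopLE L₀ i).walk,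
    ∀ y ∈ walkEdges (trailLoopLE L₀ i).walk, ‖e.1 - y.1‖ ≤ 2 * (L₀ : ℝ) := fun e he y hy =>
  (norm_sub_le_two_mul_length_of_mem_walkEdges _ he hy).trans (by have := i.2.2.2; exact_mod_cast Nat.mul_le_mul_left 2 this)

/-- **`SU(2)`, `d = 4`, `β_W = 1/8` — ALL closed trails of length `≤ L₀` at once**: every coupling function with
`∑_{γ ∋ e} |c_γ| |γ| ≤ 0.143` through every link gives a unique DLR state with exponential clustering (tier-1 row at
range `2L₀`). -/
theorem su2_trailsLE_massGapS_1_8 (L₀ : ℕ) {c : TrailIdxLE 4 L₀ → ℝ} (h : LoopNormLE 0 (trailLoopLE L₀) c (143 / 1000)) :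
    PerturbedMassGapAtS 4 2 ((1 / 8 : ℝ) / 4) (loopFamilyAction (d := 4) 2 (trailLoopLE L₀) c) :=
  su2_loopFamilyFR_massGapS_1_8 finite_fibre_trailLoopLE finite_through_trailLoopLE norm_sub_le_trailLoopLE h

/-- **Every `N ≥ 2`, `d = 4`, 't Hooft `|β| ≤ 1/64` — all closed trails of length `≤ L₀`**: `‖c‖₀ ≤ 0.11` suffices. -/
theorem suN_trailsLE_massGapS_1_64 {N : ℕ} (hN : 2 ≤ N) {β : ℝ} (hβ : |β| ≤ 1 / 64) (L₀ : ℕ)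
    {c : TrailIdxLE 4 L₀ → ℝ} (h : LoopNormLE 0 (trailLoopLE L₀) c (11 / 100)) :
    PerturbedMassGapAtS 4 N β (loopFamilyAction (d := 4) N (trailLoopLE L₀) c) :=
  suN_loopFamilyFR_massGapS_1_64 hN hβ finite_fibre_trailLoopLE finite_through_trailLoopLE norm_sub_le_trailLoopLE h

end Bounded

end Summit.Ventures.YMGap.RobustBall

end
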